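import Summits.KontsevichZagierPeriods.KontsevichZagierPeriods.Theorems.LinRedNormalFormArrangementNormalFormStubUnletterElimination

/-!
# `ArrangementNormalForm` (stmt-KontsevichZagierPeriods-3915), line `janus-bands`, stub `stub_unletter` — (4/5) splitting the weight; patterns of an order cell

Support file for `stub_unletter` (Janus band representations of base dimension `0` are congruent,
modulo `KZ.relations`, to `ℤ`-combinations of LETTERED ORDER CELLS).  The normal form of the whole
argument is a representation on the open ordered simplex
`Δ_w = KZ.openOrderedSimplex w = {1 > t₀ > ⋯ > t_{w-1} > 0}` with integrand
`cint G a t = G(t) · ∏ᵢ lett (a i) (tᵢ)` (`G` a polynomial over `ℚ`, `a i : Option ℚ` an optional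
simple constant letter, `lett (some c) x = 1/(x - c)`, `lett none x = 1`); the letters are ADMISSIBLE
(`Adm`) when none lies in `(0, 1)`, the top coordinate `t₀` is not lettered `1` and the bottom
coordinate `t_{w-1}` is not lettered `0`.  All helper declarations live in the sub-namespace
`…JanusBands.Unletter`.

This file: STEP (S) (`stepS`): an admissible all-lettered representation `[Δ_w, G ∏ 1/(tᵢ − αᵢ)]` is
split termwise (rule 1b) along the Taylor expansion of `G` at `α` into admissible — hence absolutely
convergent — terms (the constant one a lettered order cell, the others with a letter-free
coordinate); the induction on the dimension (`OC_subset_RS`); the PATTERNS `(r, σ)` of a bounded order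
cell (gap of every coordinate among sorted rational constants `κ`, order `σ` of the rescaled
coordinates): pieces are semialgebraic and pairwise disjoint, the normalising affine maps `nmap` are
bijective onto the simplex with Jacobian `∏ (gd i)⁻¹`.

References: M. Kontsevich, D. Zagier, *Periods* (2001), §1.2; D. Zagier, *Values of zeta functions
and their applications* (1994), §9 (convergence of iterated integrals).
-/

noncomputable section

open Set MeasureTheory MvPolynomial
open Literature.NumberTheory.Transcendental
open Literature.ModelTheory.ExponentialFields (IsSemialgebraic)

namespace Summit.KontsevichZagierPeriods.ArrangementNormalForm.JanusBands

/-- Registered support goal of this file: the Taylor shift `G(x) = H(x - α)` with `H = G(X + α)`. -/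
theorem unletter_aeval_taylor (w : ℕ) (G : MvPolynomial (Fin w) ℚ) (α : Fin w → ℚ) (x : Fin w → ℝ) : (MvPolynomial.aeval x G : ℝ) = MvPolynomial.aeval (fun i => x i - (α i : ℝ)) (MvPolynomial.bind₁ (fun i => MvPolynomial.X i + MvPolynomial.C (α i)) G) := by
  rw [aeval_bind₁]
  congr 1
  ext i
  simp

namespace Unletter

/-- **Step (S): splitting the polynomial weight of an all-lettered representation.** If every
admissible representation of dimension `w` with a letter-free coordinate lies in `RS`, so does
every admissible ALL-LETTERED representation `[Δ_w, G · ∏ 1/(tᵢ − αᵢ)]`: expand `G` in powers of the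
`tᵢ − αᵢ` (Taylor shift) and split the integrand termwise (rule 1b; every term is admissible, hence
absolutely convergent by `integrableOn_cint`); the constant term is a lettered order cell
(a generator of `JwSet`), every other term has a letter-free coordinate. -/
theorem stepS {w : ℕ}
    (hE : ∀ (s : KZ.IntegralRep w) (G : MvPolynomial (Fin w) ℚ) (a : Fin w → Option ℚ),
      a ∈ Adm w → s.domain = KZ.openOrderedSimplex w →
      EqOn s.integrand (cint G a) (KZ.openOrderedSimplex w) → ∀ u, a u = none → KZ.of s ∈ RS)
    (s : KZ.IntegralRep w) (G : MvPolynomial (Fin w) ℚ) (α : Fin w → ℚ)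
    (ha : (fun i => some (α i)) ∈ Adm w) (hdom : s.domain = KZ.openOrderedSimplex w)
    (hint : EqOn s.integrand (cint G fun i => some (α i)) (KZ.openOrderedSimplex w)) :
    KZ.of s ∈ RS := by
  classical
  obtain ⟨H, hH⟩ : ∃ H : MvPolynomial (Fin w) ℚ, H = bind₁ (fun i => X i + C (α i)) G := ⟨_, rfl⟩
  -- the terms of the expansion
  let Gm : (Fin w →₀ ℕ) → MvPolynomial (Fin w) ℚ := fun m =>
    C (coeff m H) * ∏ i, (X i - C (α i)) ^ (m i - 1)
  let am : (Fin w →₀ ℕ) → Fin w → Option ℚ := fun m i => if m i = 0 then some (α i) else none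
  have ham : ∀ m, am m ∈ Adm w := fun m i c hc => by
    have h0 : m i = 0 := by by_contra h; simp [am, h] at hc
    have : c = α i := by simpa [am, h0] using hc.symm
    subst this
    exact ha i _ rfl
  have hden : ∀ m, ∀ x ∈ KZ.openOrderedSimplex w, ∀ i, den (am m i) (x i) ≠ 0 := fun m x hx i =>
    den_ne_zero_of_adm (ham m) hx i
  let sm : (Fin w →₀ ℕ) → KZ.IntegralRep w := fun m => ⟨s.domain, cint (Gm m) (am m),
    s.isSemialgebraic_domain,
    by rw [hdom]; exact isSemialgebraicFunOn_cint _ _ (KZ.isSemialgebraic_openOrderedSimplex w) (hden m),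
    by rw [hdom]; exact integrableOn_cint _ (ham m)⟩
  -- rule 1b: the termwise decomposition
  have hsum : KZ.of s - ∑ m ∈ H.support, KZ.of (sm m) ∈ KZ.relations := by
    refine KZ.of_sub_sum_integrand_mem_relations H.support sm s (fun m _ => rfl) fun x hx => ?_
    rw [hdom] at hx
    have hne : ∀ i, x i - (α i : ℝ) ≠ 0 := fun i => den_ne_zero_of_adm ha hx i
    rw [hint hx, cint, unletter_aeval_taylor w G α x, ← hH, aeval_eq_sum_support, Finset.sum_mul]
    refine Finset.sum_congr rfl fun m _ => ?_
    change _ = cint (Gm m) (am m) x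
    simp only [cint, Gm, am, map_mul, map_prod, map_pow, map_sub, aeval_X, aeval_C, eq_ratCast,
      lett_some]
    rw [mul_assoc, mul_assoc, ← Finset.prod_mul_distrib, ← Finset.prod_mul_distrib]
    congr 1
    refine Finset.prod_congr rfl fun i _ => ?_
    by_cases h : m i = 0
    · simp [h]
    · rw [if_neg h, lett_none, mul_one, ← pow_sub_one_mul h]
      field_simp [hne i]
  -- every term lies in `RS`
  have hterm : ∀ m ∈ H.support, KZ.of (sm m) ∈ RS := by
    intro m _
    by_cases hm : m = 0
    · refine mem_RS_of_mem_JwSet (of_mem_JwSet (sm m) (coeff m H) α hdom fun x _ => ?_)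
      change cint (Gm m) (am m) x = _
      simp [cint, Gm, am, hm]
    · obtain ⟨i, hi⟩ : ∃ i, m i ≠ 0 := by
        by_contra h
        push Not at h
        exact hm (Finsupp.ext h)
      exact hE (sm m) (Gm m) (am m) (ham m) hdom (fun x _ => rfl) i (by simp [am, hi])
  have : KZ.of s = (KZ.of s - ∑ m ∈ H.support, KZ.of (sm m)) + ∑ m ∈ H.support, KZ.of (sm m) := by
    abel
  rw [this]
  exact add_mem (mem_RS_of_mem_relations hsum) (AddSubgroup.sum_mem _ fun m hm => hterm m hm)

/-- **Every admissible lettered simplex representation reduces to lettered order cells**: by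
induction on the dimension, alternating step (E) and step (S). -/
theorem OC_subset_RS : ∀ w, OC w ⊆ (RS : Set KZ.FormalRep) := by
  intro w
  induction w with
  | zero =>
    rintro x ⟨s, G, a, ha, hdom, hint, rfl⟩
    obtain rfl : a = fun i => some (i.elim0 : ℚ) := funext fun i => i.elim0
    exact stepS (fun s G a _ _ _ u _ => u.elim0) s G _ ha hdom hint
  | succ n ih =>
    rintro x ⟨s, G, a, ha, hdom, hint, rfl⟩
    by_cases h : ∃ u, a u = none
    · obtain ⟨u, hu⟩ := h
      exact stepE ih s G a ha hdom hint u hu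
    · push Not at h
      have hs : ∀ i, ∃ c, a i = some c := fun i => Option.ne_none_iff_exists'.1 (h i)
      choose α hα using hs
      obtain rfl : a = fun i => some (α i) := funext hα
      exact stepS (fun s G a ha hdom hint u hu => stepE ih s G a ha hdom hint u hu) s G α ha hdom hint

/-! ## Part C: dissecting a bounded order cell into normalised simplices -/

section Patterns

variable {k M : ℕ} (κ : Fin (M + 1) ↪o ℚ)

/-- Gaps have positive width. -/
theorem gd_pos (r : Fin k → Fin M) (i : Fin k) : 0 < gd κ r i :=
  sub_pos.2 (κ.strictMono (Fin.castSucc_lt_succ))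

/-- `nmapInv ∘ nmap = id`. -/
theorem nmapInv_nmap (r : Fin k → Fin M) (σ : Equiv.Perm (Fin k)) (z : Fin k → ℝ) :
    nmapInv κ r σ (nmap κ r σ z) = z := by
  ext i
  have hd : (gd κ r i : ℝ) ≠ 0 := by exact_mod_cast (gd_pos κ r i).ne'
  simp only [nmapInv, nmap, Equiv.apply_symm_apply]
  field_simp
  ring

/-- `nmap ∘ nmapInv = id`. -/
theorem nmap_nmapInv (r : Fin k → Fin M) (σ : Equiv.Perm (Fin k)) (y : Fin k → ℝ) :
    nmap κ r σ (nmapInv κ r σ y) = y := by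
  ext j
  have hd : (gd κ r (σ j) : ℝ) ≠ 0 := by exact_mod_cast (gd_pos κ r (σ j)).ne'
  simp only [nmapInv, nmap, Equiv.symm_apply_apply]
  field_simp
  ring

/-- `nmap` is a polynomial map. -/
theorem nmap_eq_aeval (r : Fin k → Fin M) (σ : Equiv.Perm (Fin k)) (z : Fin k → ℝ) :
    nmap κ r σ z = fun j => (aeval z
      (C (1 / gd κ r (σ j)) * (X (σ j) - C (glo κ r (σ j))) : MvPolynomial (Fin k) ℚ) : ℝ) := by
  ext j
  simp only [nmap, map_mul, map_sub, aeval_C, aeval_X, eq_ratCast, Rat.cast_div, Rat.cast_one]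
  ring

/-- Pieces are `ℚ`-semialgebraic. -/
theorem isSemialgebraic_piece (r : Fin k → Fin M) (σ : Equiv.Perm (Fin k)) :
    IsSemialgebraic ℚ (piece κ r σ) := by
  have h := (KZ.isSemialgebraic_openOrderedSimplex k).preimage_aeval
    (fun j => (C (1 / gd κ r (σ j)) * (X (σ j) - C (glo κ r (σ j))) : MvPolynomial (Fin k) ℚ))
  rw [piece]
  convert h using 2
  exact funext (nmap_eq_aeval κ r σ)

/-- On a piece every coordinate lies in its gap. -/
theorem mem_gap_of_mem_piece {r : Fin k → Fin M} {σ : Equiv.Perm (Fin k)} {z : Fin k → ℝ}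
    (hz : z ∈ piece κ r σ) (i : Fin k) :
    (glo κ r i : ℝ) < z i ∧ z i < glo κ r i + gd κ r i := by
  have hd : (0 : ℝ) < gd κ r i := by exact_mod_cast gd_pos κ r i
  have h0 := hz.1 (σ.symm i)
  have h1 := hz.2.1 (σ.symm i)
  simp only [nmap, Equiv.apply_symm_apply] at h0 h1
  rw [div_pos_iff_of_pos_right hd] at h0
  rw [div_lt_one hd] at h1
  constructor <;> linarith

/-- A strictly antitone rearrangement of a tuple is unique. -/
theorem perm_eq_of_strictAnti {x : Fin k → ℝ} {σ σ' : Equiv.Perm (Fin k)}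
    (h : StrictAnti (fun j => x (σ j))) (h' : StrictAnti (fun j => x (σ' j))) : σ = σ' := by
  have hρ : StrictMono (σ'.trans σ.symm) := by
    intro a b hab
    by_contra hle
    push Not at hle
    have := h.antitone hle
    simp only [Equiv.trans_apply, Equiv.apply_symm_apply] at this
    exact absurd (h' hab) (not_lt.2 this)
  have hid : ⇑(σ'.trans σ.symm) = id :=
    (hρ.range_inj strictMono_id).1 (by rw [Set.range_id]; exact (σ'.trans σ.symm).surjective.range_eq)
  ext j
  have := congr_fun hid j
  simp only [Equiv.trans_apply, id_eq] at this
  rw [Equiv.symm_apply_eq] at this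
  rw [this]

/-- Distinct patterns have disjoint pieces. -/
theorem piece_disjoint {r r' : Fin k → Fin M} {σ σ' : Equiv.Perm (Fin k)}
    (h : (r, σ) ≠ (r', σ')) : piece κ r σ ∩ piece κ r' σ' = ∅ := by
  ext z
  simp only [mem_inter_iff, mem_empty_iff_false, iff_false, not_and]
  intro hz hz'
  by_cases hr : r = r'
  · subst hr
    refine h (Prod.ext rfl (perm_eq_of_strictAnti (x := fun i => (z i - glo κ r i) / gd κ r i)
      hz.2.2 hz'.2.2))
  · obtain ⟨i, hi⟩ : ∃ i, r i ≠ r' i := by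
      by_contra hh; push Not at hh; exact hr (funext hh)
    have key : ∀ {r r' : Fin k → Fin M} {σ σ' : Equiv.Perm (Fin k)}, z ∈ piece κ r σ →
        z ∈ piece κ r' σ' → ¬ r i < r' i := by
      intro r r' σ σ' hz hz' hlt
      have h1 := (mem_gap_of_mem_piece κ hz i).2
      have h2 := (mem_gap_of_mem_piece κ hz' i).1
      have hle : κ (Fin.succ (r i)) ≤ κ (Fin.castSucc (r' i)) :=
        κ.monotone (by rw [Fin.le_def]; simp only [Fin.val_succ, Fin.val_castSucc]; omega)
      have hle' : (κ (Fin.succ (r i)) : ℝ) ≤ κ (Fin.castSucc (r' i)) := by exact_mod_cast hle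
      simp only [glo, gd, Rat.cast_sub] at h1 h2
      linarith
    rcases lt_or_gt_of_ne hi with hlt | hlt
    · exact key hz hz' hlt
    · exact key hz' hz hlt

/-- `nmapInv` is a polynomial map. -/
theorem nmapInv_eq_aeval (r : Fin k → Fin M) (σ : Equiv.Perm (Fin k)) (y : Fin k → ℝ) :
    nmapInv κ r σ y = fun i => (aeval y
      (C (glo κ r i) + C (gd κ r i) * X (σ.symm i) : MvPolynomial (Fin k) ℚ) : ℝ) := by
  ext i
  simp [nmapInv]

/-- `nmapInv` maps the simplex into the piece. -/
theorem nmapInv_mem_piece (r : Fin k → Fin M) (σ : Equiv.Perm (Fin k)) {y : Fin k → ℝ}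
    (hy : y ∈ KZ.openOrderedSimplex k) : nmapInv κ r σ y ∈ piece κ r σ := by
  rw [piece, mem_preimage, nmap_nmapInv]
  exact hy

/-- The image of a piece under `nmap` is the whole simplex. -/
theorem nmap_image_piece (r : Fin k → Fin M) (σ : Equiv.Perm (Fin k)) :
    nmap κ r σ '' piece κ r σ = KZ.openOrderedSimplex k := by
  refine Subset.antisymm (image_subset_iff.2 fun z hz => hz) fun y hy => ?_
  exact ⟨nmapInv κ r σ y, nmapInv_mem_piece κ r σ hy, nmap_nmapInv κ r σ y⟩

/-- The linear part of `nmap`, evaluated. -/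
theorem nlin_apply (r : Fin k → Fin M) (σ : Equiv.Perm (Fin k)) (v : Fin k → ℝ) :
    nlin κ r σ v = fun j => ((gd κ r (σ j) : ℝ))⁻¹ * v (σ j) := by
  classical
  ext j
  simp [nlin, nmat, Matrix.toLin'_apply, Matrix.mulVec, dotProduct, Matrix.diagonal_apply,
    Matrix.submatrix_apply]

/-- `nmap` is affine with linear part `nlin`. -/
theorem nmap_eq_nlin_add (r : Fin k → Fin M) (σ : Equiv.Perm (Fin k)) (z : Fin k → ℝ) :
    nmap κ r σ z = nlin κ r σ z + fun j => -(glo κ r (σ j) : ℝ) / gd κ r (σ j) := by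
  rw [nlin_apply]
  ext j
  simp only [nmap, Pi.add_apply]
  ring

/-- The Jacobian of `nmap`: `|det nlin| = ∏ (gd i)⁻¹`. -/
theorem abs_det_nlin (r : Fin k → Fin M) (σ : Equiv.Perm (Fin k)) :
    |(nlin κ r σ).det| = ∏ i, ((gd κ r i : ℝ))⁻¹ := by
  have h : (nlin κ r σ).det = (nmat κ r σ).det := by
    rw [ContinuousLinearMap.det, nlin, LinearMap.coe_toContinuousLinearMap, LinearMap.det_toLin']
  rw [h, nmat, Matrix.det_permute, Matrix.det_diagonal, abs_mul]
  have hpos : 0 ≤ ∏ i, ((gd κ r i : ℝ))⁻¹ :=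
    Finset.prod_nonneg fun i _ => inv_nonneg.2 (by exact_mod_cast (gd_pos κ r i).le)
  rw [abs_of_nonneg hpos]
  rcases Int.units_eq_one_or (Equiv.Perm.sign σ) with hs | hs <;> simp [hs]

end Patterns

end Unletter

end Summit.KontsevichZagierPeriods.ArrangementNormalForm.JanusBands
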